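import Summits.BirchSwinnertonDyer.BirchSwinnertonDyer.Theses.ErratumRoadFive
import Summits.BirchSwinnertonDyer.BirchSwinnertonDyer.Theorems.ErratumRoadFiveOpenInputIMCOneSided
import Summits.BirchSwinnertonDyer.Rank1Residual.X11b.RouteOpenInputsAgree
import Summits.BirchSwinnertonDyer.Rank1Residual.X11b.BDPRouteOpenInputFromLever
import Summits.BirchSwinnertonDyer.Rank1Residual.X11b.LocalTorsionTamagawa
import HarnessLib

/-!
# Route `ErratumRoadFive`, crux `OpenInputIMC` (item stmt-BirchSwinnertonDyer-19061): the open input on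
# the pairs with an ODD NON-SPLIT (ram) witness — Locus and semistable parts — WITHOUT the second
# ramified prime, and the planner's split (file 2 of 2 of seat imc-p1's session g2)

Cell `bsd-stepL`, seat `bsd-stepL-imc-p1` (prover; D-0074 row A), session g2;
`--supports stmt-BirchSwinnertonDyer-19061`. HONEST FRAMING: nothing here proves the crux; BSD is not
proved by any of this; every published ∕ cited named fact is a HYPOTHESIS; H2
(`R1.BDPValueCoreFrameOnTree`, THEOREM C♯ at memo level, print on semistable `E`), H3♭
(`P2.IMCDivIntCoreFrameAtErratumData`, ⇐ [FW21, Thm. 4.41], PREPRINT) and the typed erratum fact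
(`Castella2018.erratumThm11_…_OPEN`, p417695) are OPEN inputs. THEOREMS ONLY; pure composition of
landed kernels. File 1 = `ErratumRoadFiveOpenInputIMCOneSided` (p422211): the main-conjecture half at
erratum data WITHOUT the second prime (the twist needs only its Euler-system half, Wuthrich 2014
Prop. 21) and the one-sided tightness.

## What this file proves

* §1 **`openInputOnTreeAt_of_oddNonsplitRam_of_not_dvd_of_coreFrames`** — for EVERY globally minimal
  elliptic `W/ℚ` and prime `p` with an ODD prime `q ≠ p` of NON-split multiplicative reduction,
  `p ∤ v_q(Δ_min)`, and `p ∤ ∏_ℓ c_ℓ(E)`: H2 ∧ H3♭ ⟹ `P2OpenInputOnTreeAt W p` (11 published + 5 cited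
  named facts; `r_an = 1`, `5 ≤ p`, `mult(p)`, `irr(p)` are the crux's binders; (iv) is a THEOREM on
  `p ∤ ∏c`, `LocalTorsion.X11.aprimeLocusAt_of_not_dvd_tamagawaProduct`; control = x11b3's
  `p2ControlOnTreeAt_of_locus`). NO second prime, NO A′ bookkeeping left as hypothesis.
  **`openInputOnTreeAt_of_oddNonsplitRam_of_semistable_of_coreFrame`** — SEMISTABLE pairs with an odd
  non-split (ram) witness and (iv), ON OR OFF the Locus: from H3♭ + `h32` (H2 in print) + `h23`.
* §2 class level: children L (Locus part) ∕ L′ (semistable part); the 3-child glue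
  `openInputIMC_of_oddNonsplitRamLocus_of_semistable_of_rest` + `openInputIMC_iff_oddNonsplitRam_split`;
  **`openInputIMC_of_coreFrames_of_rest_v2`** (modulo H2 ∧ H3♭ + `h32 h23` + named facts the crux
  SHRINKS to the REST) and **`openInputIMC_of_erratumThm11_OPEN_of_bdpValueCoreFrames_of_rest`** (the
  same from the typed OPEN fact + H2, via g0's bridge `imcDivIntCoreFrameAtErratumData_of_erratumThm11_OPEN`).

CENSUS (DATA, zero-compute fold of multr1-p1 `census2_all_500k.tsv.gz`; X11b shape, `p ≥ 5`,
`N < 5·10⁵`, class-wide pairs): Locus 2 093 111; g0's child R (`R1Population ∩ Locus`) 1 201 479 →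
child L **1 412 387** (+210 908); with the semistable part 1 220 365 → L ∪ L′ = **1 432 234** of the
(ram) atom 2 155 109 (56.6 % → 66.5 %). REST ∩ (ram) = 722 875: every ramified multiplicative witness
SPLIT 531 672 (no erratum field: `w(E/K) = +1`; outside [FW21, Thm. 4.41]'s last hypothesis); only
`q = 2` non-split 149 052 (even `d_K`: outside [Cas20, §2.5], a binder of every shape); off-Locus
non-semistable 34 474 (control identity at `p ∣ ∏c` typed only for semistable `E`,
`thm23_anticyclotomicControl`); off-Locus semistable failing (iv) or without odd `q` 7 677.
CONDITIONAL; nothing booked; closes rung K2 of BirchSwinnertonDyer for NO pair by itself.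

References: [Castella2018Erratum] Thm. 1.1, (2.4), Thm. A′; [Castella2018] Thms. 2.3, 3.1, 3.2, §5
(arXiv:1704.06608); [Wuthrich2014] Prop. 21; [JetchevSkinnerWan2017] Thm. 3.3.1, §7.4.1;
[Skinner2016PacificMC] Thm. C; [SilvermanATAEC1994] Cor. IV.9.2; [Miller2011LMS] Def. 1.1.
-/

set_option autoImplicit false
set_option linter.dupNamespace false

noncomputable section

open scoped Classical

open WeierstrassCurve NumberField IsDedekindDomain Field
open Literature.NumberTheory.EllipticCurves Literature.NumberTheory.EllipticCurves.GreenbergSelmer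
open Literature.NumberTheory.EllipticCurves.ModularForms
open Literature.NumberTheory.EllipticCurves.Rank1Residual
open Literature.NumberTheory.EllipticCurves.Rank1Residual.Typed
open Literature.NumberTheory.EllipticCurves.Wuthrich2014
open Literature.NumberTheory.EllipticCurves.Castella2018
open Literature.NumberTheory.GaloisRepresentations
open Literature.NumberTheory.GaloisCohomology
open Summit.BirchSwinnertonDyer.Rank1Residual Summit.BirchSwinnertonDyer.Rank1Residual.X11b
open Summit.BirchSwinnertonDyer.BirchSwinnertonDyer.Theses

namespace Summit.BirchSwinnertonDyer.BirchSwinnertonDyer.Theorems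

/-! ### §1 Pair level: the open input on the odd-non-split-(ram) locus -/

section Pair

variable (W : WeierstrassCurve ℚ) [W.IsElliptic] [W.IsGloballyMinimal] (p : ℕ) [Fact p.Prime]

/-- **THE OPEN INPUT ON {odd non-split (ram) witness} ∩ LOCUS FROM H2 ∧ H3♭ — no second prime, no
local-torsion clause, no A′ bookkeeping.** For a globally minimal elliptic `W/ℚ` and a prime `p` with
an ODD prime `q ≠ p` of NON-split multiplicative reduction with `p ∤ v_q(Δ_min)` and
`p ∤ ∏_ℓ c_ℓ(E)`: H2 = `R1.BDPValueCoreFrameOnTree W p` ∧ H3♭ = `P2.IMCDivIntCoreFrameAtErratumData W p`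
⟹ `P2OpenInputOnTreeAt W p`, given ELEVEN published named facts (`hGZ86 hGZK hWu hSk hnf hCST hFH hMaz
hGZ hKo`) and FIVE cited ones (`hPTs hPT hPT2 hEP hcd`). The crux's binders give `r_an = 1`, `5 ≤ p`,
`mult(p)`, `irr(p)`; (iv) `E(ℚ_p)[p] = 0` is a THEOREM on `p ∤ ∏c` (`LocalTorsion`), so
`ErratumHypotheses W p`; file 1 gives the lower half (Wuthrich Prop. 21 for the twist — no second
prime) and the one-sided tightness; the control identity on the Locus is x11b3's
`p2ControlOnTreeAt_of_locus`. `hSk` is used ONLY for the CLASSICAL twist in the tightness step (its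
(ram) witness is `q` itself). CONDITIONAL on H2, H3♭; nothing booked.
[cite: Castella2018Erratum, Thm. 1.1, (2.4), Thm. A′ (pp. 1, 4)] [cite: Wuthrich2014, Prop. 21 (p. 400)]
[cite: Castella2018, Thm. 2.3 (p. 5), Thms. 3.1–3.2 (p. 9), §5 (p. 12) (arXiv:1704.06608)]
[cite: JetchevSkinnerWan2017, Thm. 3.3.1 and §7.4.1] [cite: Skinner2016PacificMC, Thm. C (§1)]
[cite: SilvermanATAEC1994, Cor. IV.9.2(d) with (b) (PDF p. 340)] [cite: Miller2011LMS, Def. 1.1] -/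
theorem openInputOnTreeAt_of_oddNonsplitRam_of_not_dvd_of_coreFrames
    (hGZ86 : GrossZagier1986_thm_I_7_3) (hGZK : rank_eq_analyticRank_of_analyticRank_le_one)
    (hWu : sha_dvd_analyticSha) (hSk : Skinner2016.thmC_padicValRat_bsd_rank_zero)
    (hnf : exists_isNewformOf) (hCST : CaiShuTian2014.thm11_trivialChar)
    (hFH : friedbergHoffstein_exists_twist_ne_zero_ramifiedAt)
    (hMaz : mazur_not_dvd_maninConstant_of_odd)
    (hGZ : ∀ (N : ℕ) [NeZero N] (W : WeierstrassCurve ℚ) (K : Type) [Field K] [NumberField K],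
      gross_zagier N W K)
    (hKo : ∀ (N : ℕ) [NeZero N] (W : WeierstrassCurve ℚ) (K : Type) [Field K] [NumberField K],
      kolyvagin N W K)
    (hPTs : ∀ (K : Type) [Field K] [NumberField K], poitouTate_sum_localTatePairing_eq_zero K)
    (hPT : ∀ (K : Type) [Field K] [NumberField K], poitouTate_selmerStructure_duality K)
    (hPT2 : ∀ (K : Type) [Field K] [NumberField K], poitouTate_sha_tateDual K)
    (hEP : ∀ (K : Type) [Field K] [NumberField K] (v : HeightOneSpectrum (𝓞 K)),
      localEulerPoincareCharacteristic (v.adicCompletion K))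
    (hcd : fieldCdLE_two_of_numberField)
    (h2 : R1.BDPValueCoreFrameOnTree W p) (h3 : P2.IMCDivIntCoreFrameAtErratumData W p)
    {q : ℕ} [Fact q.Prime] (hq2 : q ≠ 2) (hqp : q ≠ p) (hmq : Mult W q)
    (hnsq : ¬ W.HasSplitMultiplicativeReductionAtPrime q)
    (hvq : ¬ p ∣ padicValInt q W.minimalDiscriminantInt) (htam : ¬ p ∣ W.tamagawaProduct) :
    P2OpenInputOnTreeAt W p := by
  refine p2OpenInputOnTreeAt_of_imp_surj W p fun hX hp5 _hs ↦ ?_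
  have hr : W.analyticRank = 1 := hX.1
  have hmult : Mult W p := hX.2.2.1
  have hirr : Irr W p := hX.2.2.2
  have hram : Ram W p := ⟨q, ‹_›, hqp, hmq, hvq⟩
  have hE : ErratumHypotheses W p :=
    ⟨hp5, hmult, hirr, LocalTorsion.X11.aprimeLocusAt_of_not_dvd_tamagawaProduct W p (by omega) hmult
      htam hqp hmq hnsq hvq⟩
  have hlow : Typed.MissingLowerBoundAt W p :=
    missingLowerBoundAt_of_erratumHypotheses_of_coreFrames W p hGZ86 hGZK hWu hnf hCST hFH hMaz hPTs
      hEP h2 h3 hE hq2 hqp hmq hnsq hvq hr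
  exact openInputOnTreeAt_of_missingLowerBoundAt_of_ram W p hGZ hKo hSk hGZK
    (hasEntireLFunction_rat_of_exists_isNewformOf hnf)
    (p2ControlOnTreeAt_of_locus W p hKo hPT hPT2 hEP hcd hX hram htam) hram hlow

/-- **On SEMISTABLE pairs with an odd non-split (ram) witness, ON OR OFF the Locus — no second prime.**
For a globally minimal SEMISTABLE elliptic `W/ℚ`, a prime `p`, an ODD non-split multiplicative `q ≠ p`
with `p ∤ v_q(Δ_min)`, and the local-torsion clause (iv) `E(ℚ_p)[p] = 0` (a theorem unless `p` is
split with `p ∣ v_p(Δ_min)`; kept as a hypothesis because `p ∣ ∏c` is allowed here):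
H3♭ = `P2.IMCDivIntCoreFrameAtErratumData W p` ⟹ `P2OpenInputOnTreeAt W p`, given the published `hGZ86
hGZK hWu hSk hnf hCST hFH hMaz hGZ hKo`, `h32` (Cas18 Thms. 3.1–3.2: H2 in print on semistable `E`,
`R1.bdpValueCoreFrameOnTree_of_thm32`), `h23` (Cas18 Thm. 2.3: the control identity without `p ∤ ∏c`,
`p2ControlOnTreeAt_of_thm23_of_semistable`) and the cited `hPTs hEP`. g0's
`openInputOnTreeAt_of_r1Population_of_semistable_of_erratumThm11_OPEN` with the second prime REMOVED and
the typed fact replaced by the weaker H3♭. CONDITIONAL on H3♭; nothing booked.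
[cite: Castella2018Erratum, (2.4) (p. 4)] [cite: Wuthrich2014, Prop. 21 (p. 400)]
[cite: Castella2018, Thm. 2.3 (p. 5), Thms. 3.1–3.2 (p. 9), §5 (p. 12) (arXiv:1704.06608)]
[cite: Miller2011LMS, Def. 1.1] -/
theorem openInputOnTreeAt_of_oddNonsplitRam_of_semistable_of_coreFrame
    (hGZ86 : GrossZagier1986_thm_I_7_3) (hGZK : rank_eq_analyticRank_of_analyticRank_le_one)
    (hWu : sha_dvd_analyticSha) (hSk : Skinner2016.thmC_padicValRat_bsd_rank_zero)
    (hnf : exists_isNewformOf) (hCST : CaiShuTian2014.thm11_trivialChar)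
    (hFH : friedbergHoffstein_exists_twist_ne_zero_ramifiedAt)
    (hMaz : mazur_not_dvd_maninConstant_of_odd)
    (h32 : thm32_exists_isBDPLFunction_valueAtOne) (h23 : thm23_anticyclotomicControl)
    (hGZ : ∀ (N : ℕ) [NeZero N] (W : WeierstrassCurve ℚ) (K : Type) [Field K] [NumberField K],
      gross_zagier N W K)
    (hKo : ∀ (N : ℕ) [NeZero N] (W : WeierstrassCurve ℚ) (K : Type) [Field K] [NumberField K],
      kolyvagin N W K)
    (hPTs : ∀ (K : Type) [Field K] [NumberField K], poitouTate_sum_localTatePairing_eq_zero K)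
    (hEP : ∀ (K : Type) [Field K] [NumberField K] (v : HeightOneSpectrum (𝓞 K)),
      localEulerPoincareCharacteristic (v.adicCompletion K))
    (hss : Semistable W) (h3 : P2.IMCDivIntCoreFrameAtErratumData W p)
    {q : ℕ} [Fact q.Prime] (hq2 : q ≠ 2) (hqp : q ≠ p) (hmq : Mult W q)
    (hnsq : ¬ W.HasSplitMultiplicativeReductionAtPrime q)
    (hvq : ¬ p ∣ padicValInt q W.minimalDiscriminantInt)
    (htors : ∀ P : (W.baseChange ℚ_[p]).toAffine.Point, p • P = 0 → P = 0) :
    P2OpenInputOnTreeAt W p := by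
  refine p2OpenInputOnTreeAt_of_imp_surj W p fun hX hp5 _hs ↦ ?_
  have hr : W.analyticRank = 1 := hX.1
  have hram : Ram W p := ⟨q, ‹_›, hqp, hmq, hvq⟩
  have hE : ErratumHypotheses W p := ⟨hp5, hX.2.2.1, hX.2.2.2, ⟨q, ‹_›, hqp, hmq, hnsq, hvq⟩, htors⟩
  have hlow : Typed.MissingLowerBoundAt W p :=
    missingLowerBoundAt_of_erratumHypotheses_of_coreFrames W p hGZ86 hGZK hWu hnf hCST hFH hMaz hPTs
      hEP (R1.bdpValueCoreFrameOnTree_of_thm32 h32 hss) h3 hE hq2 hqp hmq hnsq hvq hr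
  exact openInputOnTreeAt_of_missingLowerBoundAt_of_ram W p hGZ hKo hSk hGZK
    (hasEntireLFunction_rat_of_exists_isNewformOf hnf)
    (p2ControlOnTreeAt_of_thm23_of_semistable W p h23 hKo hss) hram hlow

end Pair

/-! ### §2 Class level: the new children of `OpenInputIMC` and the planner's split -/

section ClassLevel

/-- **Child L (the {odd non-split (ram) witness} ∩ Locus part of `OpenInputIMC`) from H2 ∧ H3♭ at
every pair** (class level). Given the eleven published + five cited named facts, H2 and H3♭ at EVERY
pair, the crux holds at every `(W, p)` with an odd non-split multiplicative `q ≠ p`, `p ∤ v_q(Δ_min)`,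
and `p ∤ ∏_ℓ c_ℓ(E)`. Strictly contains g0's child R (`R1Population ∩ Locus`, p417457).
CONDITIONAL on H2, H3♭; nothing booked. [cite: Castella2018Erratum, Thm. 1.1, (2.4) (pp. 1, 4)]
[cite: Wuthrich2014, Prop. 21 (p. 400)] -/
theorem openInputIMC_oddNonsplitRamLocus_of_coreFrames
    (hGZ86 : GrossZagier1986_thm_I_7_3) (hGZK : rank_eq_analyticRank_of_analyticRank_le_one)
    (hWu : sha_dvd_analyticSha) (hSk : Skinner2016.thmC_padicValRat_bsd_rank_zero)
    (hnf : exists_isNewformOf) (hCST : CaiShuTian2014.thm11_trivialChar)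
    (hFH : friedbergHoffstein_exists_twist_ne_zero_ramifiedAt)
    (hMaz : mazur_not_dvd_maninConstant_of_odd)
    (hGZ : ∀ (N : ℕ) [NeZero N] (W : WeierstrassCurve ℚ) (K : Type) [Field K] [NumberField K],
      gross_zagier N W K)
    (hKo : ∀ (N : ℕ) [NeZero N] (W : WeierstrassCurve ℚ) (K : Type) [Field K] [NumberField K],
      kolyvagin N W K)
    (hPTs : ∀ (K : Type) [Field K] [NumberField K], poitouTate_sum_localTatePairing_eq_zero K)
    (hPT : ∀ (K : Type) [Field K] [NumberField K], poitouTate_selmerStructure_duality K)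
    (hPT2 : ∀ (K : Type) [Field K] [NumberField K], poitouTate_sha_tateDual K)
    (hEP : ∀ (K : Type) [Field K] [NumberField K] (v : HeightOneSpectrum (𝓞 K)),
      localEulerPoincareCharacteristic (v.adicCompletion K))
    (hcd : fieldCdLE_two_of_numberField)
    (h2 : ∀ (W : WeierstrassCurve ℚ) [W.IsElliptic] [W.IsGloballyMinimal] (p : ℕ) [Fact p.Prime],
      R1.BDPValueCoreFrameOnTree W p)
    (h3 : ∀ (W : WeierstrassCurve ℚ) [W.IsElliptic] [W.IsGloballyMinimal] (p : ℕ) [Fact p.Prime],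
      P2.IMCDivIntCoreFrameAtErratumData W p) :
    ∀ (W : WeierstrassCurve ℚ) [W.IsElliptic] [W.IsGloballyMinimal] (p : ℕ) [Fact p.Prime],
      (∃ (q : ℕ) (_ : Fact q.Prime), q ≠ 2 ∧ q ≠ p ∧ Mult W q ∧
        ¬ W.HasSplitMultiplicativeReductionAtPrime q ∧ ¬ p ∣ padicValInt q W.minimalDiscriminantInt) →
      ¬ p ∣ W.tamagawaProduct → P2OpenInputOnTreeAt W p := by
  intro W _ _ p _ hq htam
  obtain ⟨q, _, hq2, hqp, hmq, hnsq, hvq⟩ := hq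
  exact openInputOnTreeAt_of_oddNonsplitRam_of_not_dvd_of_coreFrames W p hGZ86 hGZK hWu hSk hnf hCST hFH
    hMaz hGZ hKo hPTs hPT hPT2 hEP hcd (h2 W p) (h3 W p) hq2 hqp hmq hnsq hvq htam

/-- **Child L′ (the SEMISTABLE odd-non-split-(ram) part, on OR off the Locus) from H3♭ at every pair
and NAMED FACTS** (class level): the crux at every semistable `(W, p)` with an odd non-split
`E[p]`-ramified multiplicative `q ≠ p` and (iv) `E(ℚ_p)[p] = 0`. Strictly contains g0's
`openInputIMC_r1Semistable_of_imcEqAllFrames` (p418026). CONDITIONAL on H3♭; nothing booked.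
[cite: Castella2018Erratum, (2.4) (p. 4)] [cite: Wuthrich2014, Prop. 21 (p. 400)] [cite: Miller2011LMS, Def. 1.1] -/
theorem openInputIMC_oddNonsplitRamSemistable_of_coreFrame
    (hGZ86 : GrossZagier1986_thm_I_7_3) (hGZK : rank_eq_analyticRank_of_analyticRank_le_one)
    (hWu : sha_dvd_analyticSha) (hSk : Skinner2016.thmC_padicValRat_bsd_rank_zero)
    (hnf : exists_isNewformOf) (hCST : CaiShuTian2014.thm11_trivialChar)
    (hFH : friedbergHoffstein_exists_twist_ne_zero_ramifiedAt)
    (hMaz : mazur_not_dvd_maninConstant_of_odd)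
    (h32 : thm32_exists_isBDPLFunction_valueAtOne) (h23 : thm23_anticyclotomicControl)
    (hGZ : ∀ (N : ℕ) [NeZero N] (W : WeierstrassCurve ℚ) (K : Type) [Field K] [NumberField K],
      gross_zagier N W K)
    (hKo : ∀ (N : ℕ) [NeZero N] (W : WeierstrassCurve ℚ) (K : Type) [Field K] [NumberField K],
      kolyvagin N W K)
    (hPTs : ∀ (K : Type) [Field K] [NumberField K], poitouTate_sum_localTatePairing_eq_zero K)
    (hEP : ∀ (K : Type) [Field K] [NumberField K] (v : HeightOneSpectrum (𝓞 K)),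
      localEulerPoincareCharacteristic (v.adicCompletion K))
    (h3 : ∀ (W : WeierstrassCurve ℚ) [W.IsElliptic] [W.IsGloballyMinimal] (p : ℕ) [Fact p.Prime],
      P2.IMCDivIntCoreFrameAtErratumData W p) :
    ∀ (W : WeierstrassCurve ℚ) [W.IsElliptic] [W.IsGloballyMinimal] (p : ℕ) [Fact p.Prime],
      Semistable W →
      (∃ (q : ℕ) (_ : Fact q.Prime), q ≠ 2 ∧ q ≠ p ∧ Mult W q ∧
        ¬ W.HasSplitMultiplicativeReductionAtPrime q ∧ ¬ p ∣ padicValInt q W.minimalDiscriminantInt) →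
      (∀ P : (W.baseChange ℚ_[p]).toAffine.Point, p • P = 0 → P = 0) → P2OpenInputOnTreeAt W p := by
  intro W _ _ p _ hss hq htors
  obtain ⟨q, _, hq2, hqp, hmq, hnsq, hvq⟩ := hq
  exact openInputOnTreeAt_of_oddNonsplitRam_of_semistable_of_coreFrame W p hGZ86 hGZK hWu hSk hnf hCST
    hFH hMaz h32 h23 hGZ hKo hPTs hEP hss (h3 W p) hq2 hqp hmq hnsq hvq htors

/-- **Split glue for the planner (three children, kernel-checked).** `OpenInputIMC` follows from:
child L (odd non-split (ram) witness ∧ `p ∤ ∏c`), child L′ (SEMISTABLE ∧ odd non-split (ram) witness ∧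
(iv)) and the REST (every pair in neither locus). Bookkeeping only. [folklore] -/
theorem openInputIMC_of_oddNonsplitRamLocus_of_semistable_of_rest
    (hL : ∀ (W : WeierstrassCurve ℚ) [W.IsElliptic] [W.IsGloballyMinimal] (p : ℕ) [Fact p.Prime],
      (∃ (q : ℕ) (_ : Fact q.Prime), q ≠ 2 ∧ q ≠ p ∧ Mult W q ∧
        ¬ W.HasSplitMultiplicativeReductionAtPrime q ∧ ¬ p ∣ padicValInt q W.minimalDiscriminantInt) →
      ¬ p ∣ W.tamagawaProduct → P2OpenInputOnTreeAt W p)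
    (hL' : ∀ (W : WeierstrassCurve ℚ) [W.IsElliptic] [W.IsGloballyMinimal] (p : ℕ) [Fact p.Prime],
      Semistable W →
      (∃ (q : ℕ) (_ : Fact q.Prime), q ≠ 2 ∧ q ≠ p ∧ Mult W q ∧
        ¬ W.HasSplitMultiplicativeReductionAtPrime q ∧ ¬ p ∣ padicValInt q W.minimalDiscriminantInt) →
      (∀ P : (W.baseChange ℚ_[p]).toAffine.Point, p • P = 0 → P = 0) → P2OpenInputOnTreeAt W p)
    (hrest : ∀ (W : WeierstrassCurve ℚ) [W.IsElliptic] [W.IsGloballyMinimal] (p : ℕ) [Fact p.Prime],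
      ¬ ((∃ (q : ℕ) (_ : Fact q.Prime), q ≠ 2 ∧ q ≠ p ∧ Mult W q ∧
            ¬ W.HasSplitMultiplicativeReductionAtPrime q ∧
            ¬ p ∣ padicValInt q W.minimalDiscriminantInt) ∧
          (¬ p ∣ W.tamagawaProduct ∨
            (Semistable W ∧ ∀ P : (W.baseChange ℚ_[p]).toAffine.Point, p • P = 0 → P = 0))) →
      P2OpenInputOnTreeAt W p) :
    ErratumRoadFive.OpenInputIMC := by
  unfold ErratumRoadFive.OpenInputIMC
  intro W _ _ p _
  by_cases h : (∃ (q : ℕ) (_ : Fact q.Prime), q ≠ 2 ∧ q ≠ p ∧ Mult W q ∧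
      ¬ W.HasSplitMultiplicativeReductionAtPrime q ∧ ¬ p ∣ padicValInt q W.minimalDiscriminantInt) ∧
    (¬ p ∣ W.tamagawaProduct ∨
      (Semistable W ∧ ∀ P : (W.baseChange ℚ_[p]).toAffine.Point, p • P = 0 → P = 0))
  · obtain ⟨hq, htam | ⟨hss, htors⟩⟩ := h
    · exact hL W p hq htam
    · exact hL' W p hss hq htors
  · exact hrest W p h

/-- The converse: `OpenInputIMC` ⟺ the conjunction of the three children (nothing lost). [folklore] -/
theorem openInputIMC_iff_oddNonsplitRam_split :
    ErratumRoadFive.OpenInputIMC ↔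
      (∀ (W : WeierstrassCurve ℚ) [W.IsElliptic] [W.IsGloballyMinimal] (p : ℕ) [Fact p.Prime],
        (∃ (q : ℕ) (_ : Fact q.Prime), q ≠ 2 ∧ q ≠ p ∧ Mult W q ∧
          ¬ W.HasSplitMultiplicativeReductionAtPrime q ∧
          ¬ p ∣ padicValInt q W.minimalDiscriminantInt) →
        ¬ p ∣ W.tamagawaProduct → P2OpenInputOnTreeAt W p) ∧
      (∀ (W : WeierstrassCurve ℚ) [W.IsElliptic] [W.IsGloballyMinimal] (p : ℕ) [Fact p.Prime],
        Semistable W →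
        (∃ (q : ℕ) (_ : Fact q.Prime), q ≠ 2 ∧ q ≠ p ∧ Mult W q ∧
          ¬ W.HasSplitMultiplicativeReductionAtPrime q ∧
          ¬ p ∣ padicValInt q W.minimalDiscriminantInt) →
        (∀ P : (W.baseChange ℚ_[p]).toAffine.Point, p • P = 0 → P = 0) →
        P2OpenInputOnTreeAt W p) ∧
      ∀ (W : WeierstrassCurve ℚ) [W.IsElliptic] [W.IsGloballyMinimal] (p : ℕ) [Fact p.Prime],
        ¬ ((∃ (q : ℕ) (_ : Fact q.Prime), q ≠ 2 ∧ q ≠ p ∧ Mult W q ∧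
              ¬ W.HasSplitMultiplicativeReductionAtPrime q ∧
              ¬ p ∣ padicValInt q W.minimalDiscriminantInt) ∧
            (¬ p ∣ W.tamagawaProduct ∨
              (Semistable W ∧ ∀ P : (W.baseChange ℚ_[p]).toAffine.Point, p • P = 0 → P = 0))) →
        P2OpenInputOnTreeAt W p := by
  refine ⟨fun h ↦ ⟨fun W _ _ p _ _ _ ↦ ?_, fun W _ _ p _ _ _ _ ↦ ?_, fun W _ _ p _ _ ↦ ?_⟩,
    fun h ↦ openInputIMC_of_oddNonsplitRamLocus_of_semistable_of_rest h.1 h.2.1 h.2.2⟩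
  all_goals
    unfold ErratumRoadFive.OpenInputIMC at h
    exact h W p

/-- **THE REDUCTION (class level, v2 of p417457's `openInputIMC_of_coreFrames_of_rest`).** Given the
eleven published + five cited named facts, H2 and H3♭ at every pair, the control fact `h23` and the
value fact `h32`, the crux `OpenInputIMC` follows from its own statement on the REST of the class —
the pairs with every ramified multiplicative witness split, or whose only non-split ramified witnesses
are `q = 2`, or with no (ram) witness, and the off-Locus pairs that are non-semistable or violate (iv).
Child L is discharged by H2 ∧ H3♭; child L′ by H3♭ ∧ `h32` ∧ `h23` (there H2 is print). CONDITIONAL on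
H2, H3♭ (OPEN shapes); nothing booked; no pair of class X11b is closed by this.
[cite: Castella2018Erratum, Thm. 1.1, (2.4), Thm. A′ (pp. 1, 4)] [cite: Wuthrich2014, Prop. 21 (p. 400)]
[cite: Castella2018, Thm. 2.3 (p. 5), Thms. 3.1–3.2 (p. 9), §5 (p. 12) (arXiv:1704.06608)] [cite: Miller2011LMS, Def. 1.1] -/
theorem openInputIMC_of_coreFrames_of_rest_v2
    (hGZ86 : GrossZagier1986_thm_I_7_3) (hGZK : rank_eq_analyticRank_of_analyticRank_le_one)
    (hWu : sha_dvd_analyticSha) (hSk : Skinner2016.thmC_padicValRat_bsd_rank_zero)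
    (hnf : exists_isNewformOf) (hCST : CaiShuTian2014.thm11_trivialChar)
    (hFH : friedbergHoffstein_exists_twist_ne_zero_ramifiedAt)
    (hMaz : mazur_not_dvd_maninConstant_of_odd)
    (h32 : thm32_exists_isBDPLFunction_valueAtOne) (h23 : thm23_anticyclotomicControl)
    (hGZ : ∀ (N : ℕ) [NeZero N] (W : WeierstrassCurve ℚ) (K : Type) [Field K] [NumberField K],
      gross_zagier N W K)
    (hKo : ∀ (N : ℕ) [NeZero N] (W : WeierstrassCurve ℚ) (K : Type) [Field K] [NumberField K],
      kolyvagin N W K)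
    (hPTs : ∀ (K : Type) [Field K] [NumberField K], poitouTate_sum_localTatePairing_eq_zero K)
    (hPT : ∀ (K : Type) [Field K] [NumberField K], poitouTate_selmerStructure_duality K)
    (hPT2 : ∀ (K : Type) [Field K] [NumberField K], poitouTate_sha_tateDual K)
    (hEP : ∀ (K : Type) [Field K] [NumberField K] (v : HeightOneSpectrum (𝓞 K)),
      localEulerPoincareCharacteristic (v.adicCompletion K))
    (hcd : fieldCdLE_two_of_numberField)
    (h2 : ∀ (W : WeierstrassCurve ℚ) [W.IsElliptic] [W.IsGloballyMinimal] (p : ℕ) [Fact p.Prime],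
      R1.BDPValueCoreFrameOnTree W p)
    (h3 : ∀ (W : WeierstrassCurve ℚ) [W.IsElliptic] [W.IsGloballyMinimal] (p : ℕ) [Fact p.Prime],
      P2.IMCDivIntCoreFrameAtErratumData W p)
    (hrest : ∀ (W : WeierstrassCurve ℚ) [W.IsElliptic] [W.IsGloballyMinimal] (p : ℕ) [Fact p.Prime],
      ¬ ((∃ (q : ℕ) (_ : Fact q.Prime), q ≠ 2 ∧ q ≠ p ∧ Mult W q ∧
            ¬ W.HasSplitMultiplicativeReductionAtPrime q ∧
            ¬ p ∣ padicValInt q W.minimalDiscriminantInt) ∧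
          (¬ p ∣ W.tamagawaProduct ∨
            (Semistable W ∧ ∀ P : (W.baseChange ℚ_[p]).toAffine.Point, p • P = 0 → P = 0))) →
      P2OpenInputOnTreeAt W p) :
    ErratumRoadFive.OpenInputIMC :=
  openInputIMC_of_oddNonsplitRamLocus_of_semistable_of_rest
    (openInputIMC_oddNonsplitRamLocus_of_coreFrames hGZ86 hGZK hWu hSk hnf hCST hFH hMaz hGZ hKo hPTs
      hPT hPT2 hEP hcd h2 h3)
    (openInputIMC_oddNonsplitRamSemistable_of_coreFrame hGZ86 hGZK hWu hSk hnf hCST hFH hMaz h32 h23 hGZ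
      hKo hPTs hEP h3) hrest

/-- **THE REDUCTION BY CITATION (class level).** Given the typed erratum FACT (Castella erratum Thm. 1.1
= arXiv:2409.01360 Thm. 3.1, OPEN, p417695) — which yields H3♭ on every pair by g0's bridge
`imcDivIntCoreFrameAtErratumData_of_erratumThm11_OPEN` —, H2 at every pair (THEOREM C♯; consumed only
on the Locus child, on the semistable child H2 is `h32`), the eleven published + five cited named facts
and `h32`, `h23`: the crux `OpenInputIMC` follows from its own statement on the REST. So, modulo the
unrefereed erratum ∕ [FW21, Thm. 4.41] and THEOREM C♯ off the semistable part, item 19061 SHRINKS to: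
the (ram) pairs all of whose ramified multiplicative witnesses are split, or whose only non-split
ramified witnesses are `q = 2`; the off-Locus pairs that are non-semistable or violate (iv); and the
¬(ram) pairs. CONDITIONAL (OPEN fact, H2, named facts); nothing booked; no pair closed by this.
[claim: Castella2018Erratum, status: under-review] [cite: Wuthrich2014, Prop. 21 (p. 400)]
[cite: Castella2018, Thm. 2.3 (p. 5), Thms. 3.1–3.2 (p. 9), §5 (p. 12) (arXiv:1704.06608)] [cite: Miller2011LMS, Def. 1.1] -/
theorem openInputIMC_of_erratumThm11_OPEN_of_bdpValueCoreFrames_of_rest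
    (h11 : erratumThm11_exists_isBDPLFunction_isTorsion_charIdeal_eq_OPEN)
    (hGZ86 : GrossZagier1986_thm_I_7_3) (hGZK : rank_eq_analyticRank_of_analyticRank_le_one)
    (hWu : sha_dvd_analyticSha) (hSk : Skinner2016.thmC_padicValRat_bsd_rank_zero)
    (hnf : exists_isNewformOf) (hCST : CaiShuTian2014.thm11_trivialChar)
    (hFH : friedbergHoffstein_exists_twist_ne_zero_ramifiedAt)
    (hMaz : mazur_not_dvd_maninConstant_of_odd)
    (h32 : thm32_exists_isBDPLFunction_valueAtOne) (h23 : thm23_anticyclotomicControl)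
    (hGZ : ∀ (N : ℕ) [NeZero N] (W : WeierstrassCurve ℚ) (K : Type) [Field K] [NumberField K],
      gross_zagier N W K)
    (hKo : ∀ (N : ℕ) [NeZero N] (W : WeierstrassCurve ℚ) (K : Type) [Field K] [NumberField K],
      kolyvagin N W K)
    (hPTs : ∀ (K : Type) [Field K] [NumberField K], poitouTate_sum_localTatePairing_eq_zero K)
    (hPT : ∀ (K : Type) [Field K] [NumberField K], poitouTate_selmerStructure_duality K)
    (hPT2 : ∀ (K : Type) [Field K] [NumberField K], poitouTate_sha_tateDual K)
    (hEP : ∀ (K : Type) [Field K] [NumberField K] (v : HeightOneSpectrum (𝓞 K)),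
      localEulerPoincareCharacteristic (v.adicCompletion K))
    (hcd : fieldCdLE_two_of_numberField)
    (h2 : ∀ (W : WeierstrassCurve ℚ) [W.IsElliptic] [W.IsGloballyMinimal] (p : ℕ) [Fact p.Prime],
      R1.BDPValueCoreFrameOnTree W p)
    (hrest : ∀ (W : WeierstrassCurve ℚ) [W.IsElliptic] [W.IsGloballyMinimal] (p : ℕ) [Fact p.Prime],
      ¬ ((∃ (q : ℕ) (_ : Fact q.Prime), q ≠ 2 ∧ q ≠ p ∧ Mult W q ∧
            ¬ W.HasSplitMultiplicativeReductionAtPrime q ∧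
            ¬ p ∣ padicValInt q W.minimalDiscriminantInt) ∧
          (¬ p ∣ W.tamagawaProduct ∨
            (Semistable W ∧ ∀ P : (W.baseChange ℚ_[p]).toAffine.Point, p • P = 0 → P = 0))) →
      P2OpenInputOnTreeAt W p) :
    ErratumRoadFive.OpenInputIMC :=
  openInputIMC_of_coreFrames_of_rest_v2 hGZ86 hGZK hWu hSk hnf hCST hFH hMaz h32 h23 hGZ hKo hPTs hPT
    hPT2 hEP hcd h2
    (fun W _ _ p _ ↦ imcDivIntCoreFrameAtErratumData_of_erratumThm11_OPEN (W := W) (p := p) h11) hrest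

end ClassLevel

end Summit.BirchSwinnertonDyer.BirchSwinnertonDyer.Theorems

end
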